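import Summits.AnomalousDissipation.AnomalousDissipation.Theorems.MarginalStabilityChainStrainedLayerLawClockStubNegEnstrophyLawA
import Summits.AnomalousDissipation.AnomalousDissipation.Theorems.MarginalStabilityChainStrainedLayerLawClockStubNegEnstrophyLawD
import Summits.AnomalousDissipation.AnomalousDissipation.Theorems.MarginalStabilityChainStrainedLayerLawStubStrainWorkIdentity
import Mathlib.MeasureTheory.Integral.DominatedConvergence

/-!
# Stub `stub_negEnstrophyLaw` of line `FirstLemmasR2K4` (log-enstrophy clock; crux `MarginalStabilityChain.StrainedLayerLaw`,
# stmt-AnomalousDissipation-3007) — tools E: removing the regularisation and the cutoff at one instant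

Support file (`--supports stmt-AnomalousDissipation-3007`; registered sub-goal `stub_negEnstrophyLaw_limits`). For a
`C²` divergence-free slice `(u, v)` with shear tails `SliceTails C k` (`ω = ∂ₓv − ∂_yu ∈ C¹`,
`|ω|, |∂ₓω|, |∂_yω| ≤ Ce^{−k|y|}`), the regularisation `F_ε` of `s₋²` (tools A) and the cutoff `ψ_{1/ε}` (tools F of
p120637), as `ε → 0⁺` (dominated convergence on the period strip):
* `∫∫ F_ε(ω)ψ_{1/ε} → ∫∫ ω₋²` and `∫∫ G_ε(ω)ψ_{1/ε} → ∫∫ ω₋²` (`G_ε = sF_ε′ − F_ε`);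
* `∫∫ F_ε″(ω)|∇ω|²ψ_{1/ε} → 2∫∫ 1_{ω<0}|∇ω|²` PROVIDED the set `{ω = 0, ∇ω ≠ 0}` is Lebesgue-null (on `{ω = 0, ∇ω = 0}`
  the integrand vanishes identically; `F_ε″ → 2·1_{s<0}` off `s = 0`);
together with the uniform bounds `|∫∫ G_ε(ω)ψ| ≤ C²I_k`, `|∫∫ F_ε″(ω)|∇ω|²ψ| ≤ 4C²I_k`, the strip forms of the line's
iterated functionals `negEnstrophy = ∫∫ ω₋²`, `negPalinstrophy = ∫∫ 1_{ω<0}|∇ω|²` (Fubini under the tails), and the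
integrability / measurability facts behind them. All `[folklore]`.
-/

-- `Summit.<Summit>.<Problem>` is the tree's mandated summit-side namespace (CONVENTIONS §2); for this
-- single-conjunct summit the two coincide, so the duplicate is deliberate.
set_option linter.dupNamespace false

noncomputable section

open scoped Topology ENNReal
open Filter Set Function MeasureTheory

namespace Summit.AnomalousDissipation.AnomalousDissipation.Theorems.StrainedLayerLaw.LogEnstrophyClock

open Literature.Analysis.FluidPDE Literature.Analysis.FluidPDE.StretchedLayer
open Summit.AnomalousDissipation.AnomalousDissipation.Theses.MarginalStabilityChain
open Summit.AnomalousDissipation.AnomalousDissipation.Theorems.StrainedLayerLaw.StrainWorkSumRule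

/-! ## Slice facts: tails of `∇ω`, integrability, the strip forms of `Ω₋` and `P₋` -/

section SliceFacts

variable {L C k : ℝ} {f g : ℝ → ℝ → ℝ}

/-- `|∂ₓω| = |Δv| ≤ Ce^{−k|y|}` for a `C²` divergence-free slice with shear tails. [folklore] -/
theorem clock_abs_dX_vorticity_le (hT : SliceTails C k f g) (hf : ContDiff ℝ 2 (fun q : ℝ × ℝ => f q.1 q.2))
    (hg : ContDiff ℝ 2 (fun q : ℝ × ℝ => g q.1 q.2)) (hdiv : ∀ x y, dX f x y + dY g x y = 0) (x y : ℝ) :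
    |dX (vorticity f g) x y| ≤ C * Real.exp (-k * |y|) := by
  rw [← lap_eq_dX_vorticity hf hg hdiv x y]; exact hT.abs_lap_v_le x y

/-- `|∇ω|² ≤ 2C²e^{−k|y|}` under shear tails. [folklore] -/
theorem clock_grad_vorticity_sq_le (hk : 0 < k) (hT : SliceTails C k f g)
    (hf : ContDiff ℝ 2 (fun q : ℝ × ℝ => f q.1 q.2)) (hg : ContDiff ℝ 2 (fun q : ℝ × ℝ => g q.1 q.2))
    (hdiv : ∀ x y, dX f x y + dY g x y = 0) (x y : ℝ) :
    dX (vorticity f g) x y ^ 2 + dY (vorticity f g) x y ^ 2 ≤ 2 * C ^ 2 * Real.exp (-k * |y|) := by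
  have hC : 0 ≤ C := hT.nonneg
  have hle1 : Real.exp (-k * |y|) ≤ 1 := Real.exp_le_one_iff.2 (by nlinarith [abs_nonneg y])
  have h1 := clock_abs_dX_vorticity_le hT hf hg hdiv x y
  have h2 := kato_abs_dY_vorticity_le hT hf hg hdiv x y
  have e1 : dX (vorticity f g) x y ^ 2 ≤ C ^ 2 * Real.exp (-k * |y|) := by
    have h3 : |dX (vorticity f g) x y| ≤ C := h1.trans (mul_le_of_le_one_right hC hle1)
    calc dX (vorticity f g) x y ^ 2 = |dX (vorticity f g) x y| * |dX (vorticity f g) x y| := by rw [← sq, sq_abs]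
      _ ≤ C * (C * Real.exp (-k * |y|)) := mul_le_mul h3 h1 (abs_nonneg _) hC
      _ = C ^ 2 * Real.exp (-k * |y|) := by ring
  have e2 : dY (vorticity f g) x y ^ 2 ≤ C ^ 2 * Real.exp (-k * |y|) := by
    have h3 : |dY (vorticity f g) x y| ≤ C := h2.trans (mul_le_of_le_one_right hC hle1)
    calc dY (vorticity f g) x y ^ 2 = |dY (vorticity f g) x y| * |dY (vorticity f g) x y| := by rw [← sq, sq_abs]
      _ ≤ C * (C * Real.exp (-k * |y|)) := mul_le_mul h3 h2 (abs_nonneg _) hC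
      _ = C ^ 2 * Real.exp (-k * |y|) := by ring
  linarith

/-- `ω² ≤ C²e^{−k|y|}` under shear tails. [folklore] -/
theorem clock_vorticity_sq_le (hk : 0 < k) (hT : SliceTails C k f g) (x y : ℝ) :
    vorticity f g x y ^ 2 ≤ C ^ 2 * Real.exp (-k * |y|) := by
  have hC : 0 ≤ C := hT.nonneg
  have hle1 : Real.exp (-k * |y|) ≤ 1 := Real.exp_le_one_iff.2 (by nlinarith [abs_nonneg y])
  have h1 := tails_abs_vorticity_le hT x y
  have h3 : |vorticity f g x y| ≤ C := h1.trans (mul_le_of_le_one_right hC hle1)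
  calc vorticity f g x y ^ 2 = |vorticity f g x y| * |vorticity f g x y| := by rw [← sq, sq_abs]
    _ ≤ C * (C * Real.exp (-k * |y|)) := mul_le_mul h3 h1 (abs_nonneg _) hC
    _ = C ^ 2 * Real.exp (-k * |y|) := by ring

/-- A strongly measurable function on the strip dominated by `Ce^{−k|y|}` (`k > 0`) is integrable there. [folklore] -/
theorem clock_integrableOn_strip_of_le {F : ℝ × ℝ → ℝ}
    (hF : AEStronglyMeasurable F (volume.restrict (Ioc 0 L ×ˢ univ))) (hk : 0 < k)
    (h : ∀ q : ℝ × ℝ, |F q| ≤ C * Real.exp (-k * |q.2|)) : IntegrableOn F (Ioc 0 L ×ˢ univ) :=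
  Integrable.mono' ((kato_integrableOn_weight hk L).const_mul C) hF
    (Eventually.of_forall fun q => by rw [Real.norm_eq_abs]; exact h q)

/-- The palinstrophy integrand `1_{ω<0}|∇ω|²` of a `C¹` plane function is measurable. [folklore] -/
theorem clock_measurable_negPal {ω : ℝ → ℝ → ℝ} (hω : ContDiff ℝ 1 (fun q : ℝ × ℝ => ω q.1 q.2)) :
    Measurable (fun q : ℝ × ℝ => if ω q.1 q.2 < 0 then dX ω q.1 q.2 ^ 2 + dY ω q.1 q.2 ^ 2 else 0) :=
  Measurable.ite (measurableSet_lt hω.continuous.measurable measurable_const)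
    (((continuous_dX hω).pow 2).add ((continuous_dY hω).pow 2)).measurable measurable_const

/-- `ω₋²` is integrable on the strip under shear tails. [folklore] -/
theorem clock_integrableOn_negPart_sq (hk : 0 < k) (hT : SliceTails C k f g)
    (hf : ContDiff ℝ 2 (fun q : ℝ × ℝ => f q.1 q.2)) (hg : ContDiff ℝ 2 (fun q : ℝ × ℝ => g q.1 q.2)) :
    IntegrableOn (fun q : ℝ × ℝ => (max (-(vorticity f g q.1 q.2)) 0) ^ 2) (Ioc 0 L ×ˢ univ) := by
  have cω : Continuous fun q : ℝ × ℝ => vorticity f g q.1 q.2 := (contDiff_one_vorticity hf hg).continuous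
  refine integrableOn_strip_of_abs_le_exp (by fun_prop) (sq_nonneg C) hk fun x _ y => ?_
  rw [abs_of_nonneg (sq_nonneg _)]
  exact (negPart_sq_le_sq _).trans (clock_vorticity_sq_le hk hT x y)
  where
  /-- `max(−s, 0)² ≤ s²`. [folklore] -/
  negPart_sq_le_sq (s : ℝ) : (max (-s) 0) ^ 2 ≤ s ^ 2 := by
    rcases le_or_gt 0 (-s) with h | h
    · rw [max_eq_left h]; ring_nf; exact le_rfl
    · rw [max_eq_right h.le, zero_pow two_ne_zero]; exact sq_nonneg _

/-- `1_{ω<0}|∇ω|²` is integrable on the strip under shear tails. [folklore] -/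
theorem clock_integrableOn_negPal (hk : 0 < k) (hT : SliceTails C k f g)
    (hf : ContDiff ℝ 2 (fun q : ℝ × ℝ => f q.1 q.2)) (hg : ContDiff ℝ 2 (fun q : ℝ × ℝ => g q.1 q.2))
    (hdiv : ∀ x y, dX f x y + dY g x y = 0) :
    IntegrableOn (fun q : ℝ × ℝ => if vorticity f g q.1 q.2 < 0 then
      dX (vorticity f g) q.1 q.2 ^ 2 + dY (vorticity f g) q.1 q.2 ^ 2 else 0) (Ioc 0 L ×ˢ univ) := by
  refine clock_integrableOn_strip_of_le (C := 2 * C ^ 2)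
    (clock_measurable_negPal (contDiff_one_vorticity hf hg)).aestronglyMeasurable hk fun q => ?_
  rcases q with ⟨x, y⟩
  simp only
  split_ifs
  · rw [abs_of_nonneg (by positivity)]; exact clock_grad_vorticity_sq_le hk hT hf hg hdiv x y
  · rw [abs_zero]; positivity

/-- **Strip form of `Ω₋`** under shear tails (Fubini). [folklore] -/
theorem clock_negEnstrophy_eq_strip (hk : 0 < k) (hT : SliceTails C k f g)
    (hf : ContDiff ℝ 2 (fun q : ℝ × ℝ => f q.1 q.2)) (hg : ContDiff ℝ 2 (fun q : ℝ × ℝ => g q.1 q.2)) :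
    negEnstrophy L f g = ∫ q in Ioc 0 L ×ˢ univ, (max (-(vorticity f g q.1 q.2)) 0) ^ 2 := by
  rw [negEnstrophy, integral_iterated_eq_strip (clock_integrableOn_negPart_sq hk hT hf hg)]

/-- **Strip form of `P₋`** under shear tails (Fubini). [folklore] -/
theorem clock_negPalinstrophy_eq_strip (hk : 0 < k) (hT : SliceTails C k f g)
    (hf : ContDiff ℝ 2 (fun q : ℝ × ℝ => f q.1 q.2)) (hg : ContDiff ℝ 2 (fun q : ℝ × ℝ => g q.1 q.2))
    (hdiv : ∀ x y, dX f x y + dY g x y = 0) :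
    negPalinstrophy L f g = ∫ q in Ioc 0 L ×ˢ univ, (if vorticity f g q.1 q.2 < 0 then
      dX (vorticity f g) q.1 q.2 ^ 2 + dY (vorticity f g) q.1 q.2 ^ 2 else 0) := by
  rw [negPalinstrophy, integral_iterated_eq_strip (clock_integrableOn_negPal hk hT hf hg hdiv)]

end SliceFacts

/-! ## The cutoff `ψ_{1/ε}` tends to `1` -/

/-- `ψ_{1/ε}(y) = 1` eventually as `ε → 0⁺` (namely once `ε|y| ≤ 1`). [folklore] -/
theorem clock_cutoff_tendsto_one (y : ℝ) :
    Tendsto (fun ε : ℝ => Real.smoothTransition (2 - y / ε⁻¹) * Real.smoothTransition (2 + y / ε⁻¹)) (𝓝[>] 0)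
      (𝓝 1) := by
  refine tendsto_const_nhds.congr' ?_
  have hδ : (0:ℝ) < 1 / (|y| + 1) := by positivity
  filter_upwards [Ioo_mem_nhdsGT hδ] with ε hε
  have hε0 : 0 < ε := hε.1
  have h2 : ε * (|y| + 1) < 1 := by
    have := hε.2; rwa [lt_div_iff₀ (by positivity)] at this
  have h1 : |y| ≤ ε⁻¹ := by
    rw [inv_eq_one_div, le_div_iff₀ hε0]; nlinarith [abs_nonneg y]
  exact (kato_cutoff_eq_one (inv_pos.2 hε0) h1).symm

/-! ## The limits `ε → 0⁺` at one instant -/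

section Limits

variable {L C k : ℝ} {f g : ℝ → ℝ → ℝ}

/-- Uniform bound: `|∫∫ G_ε(ω)ψ_R| ≤ C²∫∫e^{−k|y|}` (`G_ε = sF_ε′ − F_ε ∈ [0, s²]`, `|ψ_R| ≤ 1`). [folklore] -/
theorem clock_A_abs_le (hk : 0 < k) (hT : SliceTails C k f g) {ε : ℝ} (hε : 0 < ε) (R : ℝ) :
    |∫ q in Ioc 0 L ×ˢ univ, (vorticity f g q.1 q.2 *
        (vorticity f g q.1 q.2 - Real.sqrt (vorticity f g q.1 q.2 ^ 2 + ε ^ 2) / 2 -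
          vorticity f g q.1 q.2 * (vorticity f g q.1 q.2 / Real.sqrt (vorticity f g q.1 q.2 ^ 2 + ε ^ 2)) / 2) -
        (vorticity f g q.1 q.2 ^ 2 - vorticity f g q.1 q.2 * Real.sqrt (vorticity f g q.1 q.2 ^ 2 + ε ^ 2)) / 2) *
      (Real.smoothTransition (2 - q.2 / R) * Real.smoothTransition (2 + q.2 / R))| ≤
      C ^ 2 * ∫ q in Ioc 0 L ×ˢ univ, Real.exp (-k * |q.2|) := by
  rw [← integral_const_mul, ← Real.norm_eq_abs]
  refine norm_integral_le_of_norm_le ((kato_integrableOn_weight hk L).const_mul _) (Eventually.of_forall fun q => ?_)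
  rw [Real.norm_eq_abs, abs_mul]
  calc _ ≤ vorticity f g q.1 q.2 ^ 2 * 1 :=
        mul_le_mul (clock_G_abs_le hε _) (kato_cutoff_abs_le_one R q.2) (abs_nonneg _) (sq_nonneg _)
    _ ≤ C ^ 2 * Real.exp (-k * |q.2|) := by rw [mul_one]; exact clock_vorticity_sq_le hk hT q.1 q.2

/-- Uniform bound: `|∫∫ F_ε″(ω)|∇ω|²ψ_R| ≤ 4C²∫∫e^{−k|y|}` (`0 ≤ F_ε″ ≤ 2`, `|∇ω|² ≤ 2C²e^{−k|y|}`). [folklore] -/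
theorem clock_C_abs_le (hk : 0 < k) (hT : SliceTails C k f g) (hf : ContDiff ℝ 2 (fun q : ℝ × ℝ => f q.1 q.2))
    (hg : ContDiff ℝ 2 (fun q : ℝ × ℝ => g q.1 q.2)) (hdiv : ∀ x y, dX f x y + dY g x y = 0) {ε : ℝ} (hε : 0 < ε)
    (R : ℝ) :
    |∫ q in Ioc 0 L ×ˢ univ, (1 - vorticity f g q.1 q.2 / Real.sqrt (vorticity f g q.1 q.2 ^ 2 + ε ^ 2) -
        vorticity f g q.1 q.2 * (ε ^ 2 / ((vorticity f g q.1 q.2 ^ 2 + ε ^ 2) *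
          Real.sqrt (vorticity f g q.1 q.2 ^ 2 + ε ^ 2))) / 2) *
        (dX (vorticity f g) q.1 q.2 ^ 2 + dY (vorticity f g) q.1 q.2 ^ 2) *
      (Real.smoothTransition (2 - q.2 / R) * Real.smoothTransition (2 + q.2 / R))| ≤
      4 * C ^ 2 * ∫ q in Ioc 0 L ×ˢ univ, Real.exp (-k * |q.2|) := by
  rw [← integral_const_mul, ← Real.norm_eq_abs]
  refine norm_integral_le_of_norm_le ((kato_integrableOn_weight hk L).const_mul _) (Eventually.of_forall fun q => ?_)
  rw [Real.norm_eq_abs, abs_mul, abs_mul, abs_of_nonneg (by positivity : (0:ℝ) ≤ dX (vorticity f g) q.1 q.2 ^ 2 +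
    dY (vorticity f g) q.1 q.2 ^ 2)]
  have h1 := clock_Fpp_abs_le hε (vorticity f g q.1 q.2)
  have h2 := clock_grad_vorticity_sq_le hk hT hf hg hdiv q.1 q.2
  have h3 := kato_cutoff_abs_le_one R q.2
  calc _ ≤ 2 * (2 * C ^ 2 * Real.exp (-k * |q.2|)) * 1 :=
        mul_le_mul (mul_le_mul h1 h2 (by positivity) zero_le_two) h3 (abs_nonneg _) (by positivity)
    _ = 4 * C ^ 2 * Real.exp (-k * |q.2|) := by ring

/-- **`∫∫ F_ε(ω)ψ_{1/ε} → ∫∫ ω₋²`** as `ε → 0⁺` (dominated convergence: `|F_ε(ω)| ≤ |ω|(|ω| + 1)` for `ε ≤ 1`).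
[folklore] -/
theorem clock_limit_N (hk : 0 < k) (hT : SliceTails C k f g) (hf : ContDiff ℝ 2 (fun q : ℝ × ℝ => f q.1 q.2))
    (hg : ContDiff ℝ 2 (fun q : ℝ × ℝ => g q.1 q.2)) :
    Tendsto (fun ε : ℝ => ∫ q in Ioc 0 L ×ˢ univ,
      (vorticity f g q.1 q.2 ^ 2 - vorticity f g q.1 q.2 * Real.sqrt (vorticity f g q.1 q.2 ^ 2 + ε ^ 2)) / 2 *
        (Real.smoothTransition (2 - q.2 / ε⁻¹) * Real.smoothTransition (2 + q.2 / ε⁻¹))) (𝓝[>] 0)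
      (𝓝 (∫ q in Ioc 0 L ×ˢ univ, (max (-(vorticity f g q.1 q.2)) 0) ^ 2)) := by
  have hC : 0 ≤ C := hT.nonneg
  have cω : Continuous fun q : ℝ × ℝ => vorticity f g q.1 q.2 := (contDiff_one_vorticity hf hg).continuous
  have hωb : ∀ x y, |vorticity f g x y| ≤ C * Real.exp (-k * |y|) := tails_abs_vorticity_le hT
  have hle1 : ∀ y : ℝ, Real.exp (-k * |y|) ≤ 1 := fun y => Real.exp_le_one_iff.2 (by nlinarith [abs_nonneg y])
  have hωC : ∀ x y, |vorticity f g x y| ≤ C := fun x y => (hωb x y).trans (mul_le_of_le_one_right hC (hle1 y))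
  refine tendsto_integral_filter_of_dominated_convergence (fun q => C * (C + 1) * Real.exp (-k * |q.2|)) ?_ ?_ ?_ ?_
  · exact Eventually.of_forall fun ε => (((clock_F_continuous ε).comp cω).mul
      ((kato_cutoff_contDiff ε⁻¹).continuous.comp continuous_snd)).aestronglyMeasurable
  · filter_upwards [Ioo_mem_nhdsGT one_pos] with ε hε
    have hε0 : 0 < ε := hε.1
    refine Eventually.of_forall fun q => ?_
    rw [Real.norm_eq_abs, abs_mul]
    have h1 := clock_F_abs_le hε0 (vorticity f g q.1 q.2)
    have h2 := kato_cutoff_abs_le_one ε⁻¹ q.2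
    have h3 : |vorticity f g q.1 q.2| + ε ≤ C + 1 := by linarith [hωC q.1 q.2, hε.2]
    calc _ ≤ |vorticity f g q.1 q.2| * (|vorticity f g q.1 q.2| + ε) * 1 :=
          mul_le_mul h1 h2 (abs_nonneg _) (by positivity)
      _ ≤ C * Real.exp (-k * |q.2|) * (C + 1) * 1 :=
          mul_le_mul_of_nonneg_right (mul_le_mul (hωb q.1 q.2) h3 (by positivity) (by positivity)) zero_le_one
      _ = C * (C + 1) * Real.exp (-k * |q.2|) := by ring
  · exact (kato_integrableOn_weight hk L).const_mul _
  · refine Eventually.of_forall fun q => ?_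
    have h := (clock_F_tendsto (vorticity f g q.1 q.2)).mul (clock_cutoff_tendsto_one q.2)
    rwa [mul_one] at h

/-- **`∫∫ G_ε(ω)ψ_{1/ε} → ∫∫ ω₋²`** as `ε → 0⁺` (dominated convergence: `0 ≤ G_ε(ω) ≤ ω²`). [folklore] -/
theorem clock_limit_A (hk : 0 < k) (hT : SliceTails C k f g) (hf : ContDiff ℝ 2 (fun q : ℝ × ℝ => f q.1 q.2))
    (hg : ContDiff ℝ 2 (fun q : ℝ × ℝ => g q.1 q.2)) :
    Tendsto (fun ε : ℝ => ∫ q in Ioc 0 L ×ˢ univ, (vorticity f g q.1 q.2 *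
        (vorticity f g q.1 q.2 - Real.sqrt (vorticity f g q.1 q.2 ^ 2 + ε ^ 2) / 2 -
          vorticity f g q.1 q.2 * (vorticity f g q.1 q.2 / Real.sqrt (vorticity f g q.1 q.2 ^ 2 + ε ^ 2)) / 2) -
        (vorticity f g q.1 q.2 ^ 2 - vorticity f g q.1 q.2 * Real.sqrt (vorticity f g q.1 q.2 ^ 2 + ε ^ 2)) / 2) *
      (Real.smoothTransition (2 - q.2 / ε⁻¹) * Real.smoothTransition (2 + q.2 / ε⁻¹))) (𝓝[>] 0)
      (𝓝 (∫ q in Ioc 0 L ×ˢ univ, (max (-(vorticity f g q.1 q.2)) 0) ^ 2)) := by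
  have cω : Continuous fun q : ℝ × ℝ => vorticity f g q.1 q.2 := (contDiff_one_vorticity hf hg).continuous
  refine tendsto_integral_filter_of_dominated_convergence (fun q => C ^ 2 * Real.exp (-k * |q.2|)) ?_ ?_ ?_ ?_
  · filter_upwards [self_mem_nhdsWithin] with ε hε
    have hε' : (0:ℝ) < ε := hε
    have cG : Continuous fun s : ℝ => s * (s - Real.sqrt (s ^ 2 + ε ^ 2) / 2 - s * (s / Real.sqrt (s ^ 2 + ε ^ 2)) / 2) -
        (s ^ 2 - s * Real.sqrt (s ^ 2 + ε ^ 2)) / 2 := (continuous_id.mul (clock_Fp_continuous hε')).sub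
      (clock_F_continuous ε)
    exact ((cG.comp cω).mul ((kato_cutoff_contDiff ε⁻¹).continuous.comp continuous_snd)).aestronglyMeasurable
  · filter_upwards [self_mem_nhdsWithin] with ε hε
    have hε' : (0:ℝ) < ε := hε
    refine Eventually.of_forall fun q => ?_
    rw [Real.norm_eq_abs, abs_mul]
    calc _ ≤ vorticity f g q.1 q.2 ^ 2 * 1 :=
          mul_le_mul (clock_G_abs_le hε' _) (kato_cutoff_abs_le_one ε⁻¹ q.2) (abs_nonneg _) (sq_nonneg _)
      _ ≤ C ^ 2 * Real.exp (-k * |q.2|) := by rw [mul_one]; exact clock_vorticity_sq_le hk hT q.1 q.2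
  · exact (kato_integrableOn_weight hk L).const_mul _
  · refine Eventually.of_forall fun q => ?_
    have h := (clock_G_tendsto (vorticity f g q.1 q.2)).mul (clock_cutoff_tendsto_one q.2)
    rwa [mul_one] at h

/-- **`∫∫ F_ε″(ω)|∇ω|²ψ_{1/ε} → 2∫∫ 1_{ω<0}|∇ω|²`** as `ε → 0⁺`, provided `{ω = 0, ∇ω ≠ 0}` is Lebesgue-null
(dominated convergence: `0 ≤ F_ε″ ≤ 2`, `|∇ω|² ≤ 2C²e^{−k|y|}`; off the null set the integrand converges pointwise,
since `F_ε″(s) → 2·1_{s<0}` for `s ≠ 0` and the integrand vanishes identically where `ω = 0 = ∇ω`). [folklore] -/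
theorem clock_limit_C (hk : 0 < k) (hT : SliceTails C k f g) (hf : ContDiff ℝ 2 (fun q : ℝ × ℝ => f q.1 q.2))
    (hg : ContDiff ℝ 2 (fun q : ℝ × ℝ => g q.1 q.2)) (hdiv : ∀ x y, dX f x y + dY g x y = 0)
    (hnull : volume {q : ℝ × ℝ | vorticity f g q.1 q.2 = 0 ∧
      (dX (vorticity f g) q.1 q.2 ≠ 0 ∨ dY (vorticity f g) q.1 q.2 ≠ 0)} = 0) :
    Tendsto (fun ε : ℝ => ∫ q in Ioc 0 L ×ˢ univ,
      (1 - vorticity f g q.1 q.2 / Real.sqrt (vorticity f g q.1 q.2 ^ 2 + ε ^ 2) -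
        vorticity f g q.1 q.2 * (ε ^ 2 / ((vorticity f g q.1 q.2 ^ 2 + ε ^ 2) *
          Real.sqrt (vorticity f g q.1 q.2 ^ 2 + ε ^ 2))) / 2) *
        (dX (vorticity f g) q.1 q.2 ^ 2 + dY (vorticity f g) q.1 q.2 ^ 2) *
      (Real.smoothTransition (2 - q.2 / ε⁻¹) * Real.smoothTransition (2 + q.2 / ε⁻¹))) (𝓝[>] 0)
      (𝓝 (2 * ∫ q in Ioc 0 L ×ˢ univ, (if vorticity f g q.1 q.2 < 0 then
        dX (vorticity f g) q.1 q.2 ^ 2 + dY (vorticity f g) q.1 q.2 ^ 2 else 0))) := by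
  have hω1 : ContDiff ℝ 1 (fun q : ℝ × ℝ => vorticity f g q.1 q.2) := contDiff_one_vorticity hf hg
  have cω : Continuous fun q : ℝ × ℝ => vorticity f g q.1 q.2 := hω1.continuous
  have cωx : Continuous fun q : ℝ × ℝ => dX (vorticity f g) q.1 q.2 := continuous_dX hω1
  have cωy : Continuous fun q : ℝ × ℝ => dY (vorticity f g) q.1 q.2 := continuous_dY hω1
  rw [← integral_const_mul]
  refine tendsto_integral_filter_of_dominated_convergence (fun q => 4 * C ^ 2 * Real.exp (-k * |q.2|)) ?_ ?_ ?_ ?_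
  · filter_upwards [self_mem_nhdsWithin] with ε hε
    have hε' : (0:ℝ) < ε := hε
    exact ((((clock_Fpp_continuous hε').comp cω).mul ((cωx.pow 2).add (cωy.pow 2))).mul
      ((kato_cutoff_contDiff ε⁻¹).continuous.comp continuous_snd)).aestronglyMeasurable
  · filter_upwards [self_mem_nhdsWithin] with ε hε
    have hε' : (0:ℝ) < ε := hε
    refine Eventually.of_forall fun q => ?_
    rw [Real.norm_eq_abs, abs_mul, abs_mul, abs_of_nonneg (by positivity : (0:ℝ) ≤ dX (vorticity f g) q.1 q.2 ^ 2 +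
      dY (vorticity f g) q.1 q.2 ^ 2)]
    have h1 := clock_Fpp_abs_le hε' (vorticity f g q.1 q.2)
    have h2 := clock_grad_vorticity_sq_le hk hT hf hg hdiv q.1 q.2
    have h3 := kato_cutoff_abs_le_one ε⁻¹ q.2
    calc _ ≤ 2 * (2 * C ^ 2 * Real.exp (-k * |q.2|)) * 1 :=
          mul_le_mul (mul_le_mul h1 h2 (by positivity) zero_le_two) h3 (abs_nonneg _) (by positivity)
      _ = 4 * C ^ 2 * Real.exp (-k * |q.2|) := by ring
  · exact (kato_integrableOn_weight hk L).const_mul _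
  · have hae : ∀ᵐ q : ℝ × ℝ ∂volume, q ∉ {q : ℝ × ℝ | vorticity f g q.1 q.2 = 0 ∧
        (dX (vorticity f g) q.1 q.2 ≠ 0 ∨ dY (vorticity f g) q.1 q.2 ≠ 0)} :=
      measure_eq_zero_iff_ae_notMem.1 hnull
    filter_upwards [ae_restrict_of_ae (s := Ioc 0 L ×ˢ univ) hae] with q hq
    have hq' : vorticity f g q.1 q.2 = 0 → dX (vorticity f g) q.1 q.2 = 0 ∧ dY (vorticity f g) q.1 q.2 = 0 := by
      intro h0
      by_contra hc
      exact hq ⟨h0, not_and_or.1 hc⟩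
    have hψ := clock_cutoff_tendsto_one q.2
    rcases lt_trichotomy (vorticity f g q.1 q.2) 0 with hneg | hzero | hpos
    · rw [if_pos hneg]
      have h := ((clock_Fpp_tendsto_of_neg hneg).mul_const (dX (vorticity f g) q.1 q.2 ^ 2 +
        dY (vorticity f g) q.1 q.2 ^ 2)).mul hψ
      rwa [mul_one] at h
    · obtain ⟨hx, hy⟩ := hq' hzero
      have e : (fun ε : ℝ => (1 - vorticity f g q.1 q.2 / Real.sqrt (vorticity f g q.1 q.2 ^ 2 + ε ^ 2) -
          vorticity f g q.1 q.2 * (ε ^ 2 / ((vorticity f g q.1 q.2 ^ 2 + ε ^ 2) *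
            Real.sqrt (vorticity f g q.1 q.2 ^ 2 + ε ^ 2))) / 2) *
          (dX (vorticity f g) q.1 q.2 ^ 2 + dY (vorticity f g) q.1 q.2 ^ 2) *
          (Real.smoothTransition (2 - q.2 / ε⁻¹) * Real.smoothTransition (2 + q.2 / ε⁻¹))) = fun _ => 0 := by
        funext ε; rw [hx, hy]; ring
      rw [e, if_neg (by rw [hzero]; exact lt_irrefl 0), mul_zero]
      exact tendsto_const_nhds
    · rw [if_neg (not_lt.2 hpos.le), mul_zero]
      have h := ((clock_Fpp_tendsto_of_pos hpos).mul_const (dX (vorticity f g) q.1 q.2 ^ 2 +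
        dY (vorticity f g) q.1 q.2 ^ 2)).mul hψ
      rwa [zero_mul, zero_mul] at h

end Limits

/-! ## The registered sub-goal: the three limits, bundled -/

/-- **Tools E for `stub_negEnstrophyLaw` (registered sub-goal `stub_negEnstrophyLaw_limits`).** For a `C²`
divergence-free slice with shear tails `SliceTails C k` (`k > 0`), as `ε → 0⁺` with the regularisation `F_ε` of
`s₋²` and the cutoff `ψ_{1/ε}`: `∫∫ F_ε(ω)ψ_{1/ε} → ∫∫ ω₋²`, `∫∫ G_ε(ω)ψ_{1/ε} → ∫∫ ω₋²`, and — if `{ω = 0, ∇ω ≠ 0}` is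
Lebesgue-null — `∫∫ F_ε″(ω)|∇ω|²ψ_{1/ε} → 2∫∫ 1_{ω<0}|∇ω|²`. [folklore] -/
theorem stub_negEnstrophyLaw_limits : ∀ (L C k : ℝ) (f g : ℝ → ℝ → ℝ), 0 < k → SliceTails C k f g →
    ContDiff ℝ 2 (fun q : ℝ × ℝ => f q.1 q.2) → ContDiff ℝ 2 (fun q : ℝ × ℝ => g q.1 q.2) →
    (∀ x y, dX f x y + dY g x y = 0) →
      Tendsto (fun ε : ℝ => ∫ q in Ioc 0 L ×ˢ univ,
        (vorticity f g q.1 q.2 ^ 2 - vorticity f g q.1 q.2 * Real.sqrt (vorticity f g q.1 q.2 ^ 2 + ε ^ 2)) / 2 *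
          (Real.smoothTransition (2 - q.2 / ε⁻¹) * Real.smoothTransition (2 + q.2 / ε⁻¹))) (𝓝[>] 0)
        (𝓝 (∫ q in Ioc 0 L ×ˢ univ, (max (-(vorticity f g q.1 q.2)) 0) ^ 2)) ∧
      Tendsto (fun ε : ℝ => ∫ q in Ioc 0 L ×ˢ univ, (vorticity f g q.1 q.2 *
          (vorticity f g q.1 q.2 - Real.sqrt (vorticity f g q.1 q.2 ^ 2 + ε ^ 2) / 2 -
            vorticity f g q.1 q.2 * (vorticity f g q.1 q.2 / Real.sqrt (vorticity f g q.1 q.2 ^ 2 + ε ^ 2)) / 2) -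
          (vorticity f g q.1 q.2 ^ 2 - vorticity f g q.1 q.2 * Real.sqrt (vorticity f g q.1 q.2 ^ 2 + ε ^ 2)) / 2) *
        (Real.smoothTransition (2 - q.2 / ε⁻¹) * Real.smoothTransition (2 + q.2 / ε⁻¹))) (𝓝[>] 0)
        (𝓝 (∫ q in Ioc 0 L ×ˢ univ, (max (-(vorticity f g q.1 q.2)) 0) ^ 2)) ∧
      (volume {q : ℝ × ℝ | vorticity f g q.1 q.2 = 0 ∧
          (dX (vorticity f g) q.1 q.2 ≠ 0 ∨ dY (vorticity f g) q.1 q.2 ≠ 0)} = 0 →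
        Tendsto (fun ε : ℝ => ∫ q in Ioc 0 L ×ˢ univ,
          (1 - vorticity f g q.1 q.2 / Real.sqrt (vorticity f g q.1 q.2 ^ 2 + ε ^ 2) -
            vorticity f g q.1 q.2 * (ε ^ 2 / ((vorticity f g q.1 q.2 ^ 2 + ε ^ 2) *
              Real.sqrt (vorticity f g q.1 q.2 ^ 2 + ε ^ 2))) / 2) *
            (dX (vorticity f g) q.1 q.2 ^ 2 + dY (vorticity f g) q.1 q.2 ^ 2) *
          (Real.smoothTransition (2 - q.2 / ε⁻¹) * Real.smoothTransition (2 + q.2 / ε⁻¹))) (𝓝[>] 0)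
          (𝓝 (2 * ∫ q in Ioc 0 L ×ˢ univ, (if vorticity f g q.1 q.2 < 0 then
            dX (vorticity f g) q.1 q.2 ^ 2 + dY (vorticity f g) q.1 q.2 ^ 2 else 0)))) :=
  fun _ _ _ _ _ hk hT hf hg hdiv =>
    ⟨clock_limit_N hk hT hf hg, clock_limit_A hk hT hf hg, fun hnull => clock_limit_C hk hT hf hg hdiv hnull⟩

end Summit.AnomalousDissipation.AnomalousDissipation.Theorems.StrainedLayerLaw.LogEnstrophyClock

end
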